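import Mathlib
import Summits.QuantumFields.BalabanUV.Beta.MultilinearJet

/-!
# MultilinearJetUnique — uniqueness of the multilinear 3-jet (an1 node 12c, part 1b of 4)

HONEST FRAMING.  Discharging `BetaPertH` would make Bałaban's UV stability UNCONDITIONAL — a constructive-QFT
result; it is NOT the continuum limit and NOT the Clay problem.  This file discharges nothing of it: pure calculus
over `MultilinearJet` (part 1).  ABSOLUTE RULE respected: nothing is cited, nothing is asserted about the manuscripts
under audit.  [folklore]

## Content

`eq_zero_of_ev_mem_flat`: a flat multilinear polynomial germ `ev p` is zero; hence `mem_jets_unique` /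
`jets_subsingleton`: an analytic germ `f : ℂ³ → 𝔸` has AT MOST ONE multilinear 3-jet `q ∈ jets f` — so every
coefficient of `q`, in particular «the `st₁t₂`-coefficient» `c11 q.snd` that nodes 12/12b tabulate, is an intrinsic
invariant of the germ `f`.  Method: orders `0,1,2` by limits along lines `u ↦ u•v` through `0` (one complex variable,
`line_coeffs`), order `3` by the derivative of the line remainder along the four sign vectors `w3 = (1,1,1)`,
`u0 = (−1,1,1)`, `u1 = (1,−1,1)`, `u2 = (1,1,−1)` (one representative of each of the four lines `{±v}`, `v ∈ {±1}³`,
through `0`; `w3 − u0 − u1 − u2 = 0` isolates the `st₁t₂`-coefficient).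
-/

noncomputable section

set_option synthInstance.maxHeartbeats 400000

open scoped Topology
open Filter
open Literature.MathematicalPhysics.QuantumFieldTheory.Balaban1983to89.Beta.AveragingThirdJet
open Literature.MathematicalPhysics.QuantumFieldTheory.Balaban1983to89.Beta.AveragingThirdJet.Tau

namespace Summit.QuantumFields.BalabanUV.Beta.MultilinearJet

variable {𝔸 : Type*} [NormedRing 𝔸] [NormedAlgebra ℂ 𝔸]

/-! ## §4 Uniqueness of jets -/

section Unique

/-- One complex variable: if `u•A₁ + u²•A₂ + u³•A₃ = u²•R u` near `0` with `R` analytic at `0`, then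
`A₁ = 0`, `A₂ = R 0`, `A₃ = R′ 0`. -/
theorem line_coeffs {A1 A2 A3 : 𝔸} {R : ℂ → 𝔸} (hR : AnalyticAt ℂ R 0)
    (h : ∀ᶠ u in 𝓝 (0 : ℂ), u • A1 + (u * u) • A2 + (u * u * u) • A3 = (u * u) • R u) :
    A1 = 0 ∧ A2 = R 0 ∧ A3 = deriv R 0 := by
  have hne : ∀ᶠ u in 𝓝[≠] (0 : ℂ), u ≠ 0 := self_mem_nhdsWithin
  have hRc : ContinuousAt R 0 := hR.continuousAt
  -- cancel one `u`
  have h1 : ∀ᶠ u in 𝓝[≠] (0 : ℂ), A1 + u • A2 + (u * u) • A3 = u • R u := by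
    filter_upwards [nhdsWithin_le_nhds h, hne] with u hu hne
    have e : u • (A1 + u • A2 + (u * u) • A3) = u • (u • R u) := by rw [smul_smul u u (R u), ← hu]; module
    have := congrArg (fun z => u⁻¹ • z) e
    simpa only [inv_smul_smul₀ hne] using this
  -- order 1
  have hA1 : A1 = 0 := by
    have hφ : Tendsto (fun u : ℂ => A1 + u • A2 + (u * u) • A3 - u • R u) (𝓝[≠] 0) (𝓝 A1) := by
      have hc : ContinuousAt (fun u : ℂ => A1 + u • A2 + (u * u) • A3 - u • R u) 0 := by fun_prop
      simpa using hc.tendsto.mono_left nhdsWithin_le_nhds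
    have h0 : Tendsto (fun u : ℂ => A1 + u • A2 + (u * u) • A3 - u • R u) (𝓝[≠] 0) (𝓝 0) :=
      tendsto_const_nhds.congr' (by filter_upwards [h1] with u hu; rw [hu, sub_self])
    exact tendsto_nhds_unique hφ h0
  -- cancel another `u`
  have h2 : ∀ᶠ u in 𝓝[≠] (0 : ℂ), A2 + u • A3 = R u := by
    filter_upwards [h1, hne] with u hu hne
    rw [hA1, zero_add] at hu
    have e : u • (A2 + u • A3) = u • R u := by rw [← hu]; module
    have := congrArg (fun z => u⁻¹ • z) e
    simpa only [inv_smul_smul₀ hne] using this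
  -- order 2
  have hA2 : A2 = R 0 := by
    have hφ : Tendsto (fun u : ℂ => A2 + u • A3 - R u) (𝓝[≠] 0) (𝓝 (A2 - R 0)) := by
      have hc : ContinuousAt (fun u : ℂ => A2 + u • A3 - R u) 0 := by fun_prop
      simpa using hc.tendsto.mono_left nhdsWithin_le_nhds
    have h0 : Tendsto (fun u : ℂ => A2 + u • A3 - R u) (𝓝[≠] 0) (𝓝 0) :=
      tendsto_const_nhds.congr' (by filter_upwards [h2] with u hu; rw [hu, sub_self])
    exact sub_eq_zero.1 (tendsto_nhds_unique hφ h0)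
  -- order 3: the slope of `R` at `0` is eventually the constant `A3`
  have hA3 : A3 = deriv R 0 := by
    have hd := hasDerivAt_iff_tendsto_slope_zero.1 hR.differentiableAt.hasDerivAt
    simp only [zero_add] at hd
    have hc : Tendsto (fun t : ℂ => t⁻¹ • (R t - R 0)) (𝓝[≠] 0) (𝓝 A3) := by
      apply tendsto_const_nhds.congr'
      filter_upwards [h2, hne] with u hu hne
      rw [← hu, ← hA2, add_sub_cancel_left, smul_smul, inv_mul_cancel₀ hne, one_smul]
    exact tendsto_nhds_unique hc hd
  exact ⟨hA1, hA2, hA3⟩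

/-- The four sign vectors used to read off the `st₁t₂`-coefficient. -/
def w3 : P3 := fun _ => 1
/-- (see `w3`) -/
def u0 : P3 := fun i => if i = 0 then -1 else 1
/-- (see `w3`) -/
def u1 : P3 := fun i => if i = 1 then -1 else 1
/-- (see `w3`) -/
def u2 : P3 := fun i => if i = 2 then -1 else 1

/-- Components of the test vector `w3 = (1,1,1)`. -/
@[simp] theorem w3_apply (i : Fin 3) : w3 i = 1 := rfl
/-- Components of the test vector `u0 = (-1,1,1)`. -/
@[simp] theorem u0_apply (i : Fin 3) : u0 i = if i = 0 then -1 else 1 := rfl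
/-- Components of the test vector `u1 = (1,-1,1)`. -/
@[simp] theorem u1_apply (i : Fin 3) : u1 i = if i = 1 then -1 else 1 := rfl
/-- Components of the test vector `u2 = (1,1,-1)`. -/
@[simp] theorem u2_apply (i : Fin 3) : u2 i = if i = 2 then -1 else 1 := rfl

/-- The signed sum `w3 − u0 − u1 − u2` of the test vectors vanishes. -/
theorem w3_sub : w3 - u0 - u1 - u2 = 0 := by
  funext j; fin_cases j <;> simp

variable {p : Rho 𝔸}

/-- The line coefficients of `ev p` along `u ↦ u • v`. -/
def A1 (p : Rho 𝔸) (v : P3) : 𝔸 := (v 1) • c10 p.fst + (v 2) • c01 p.fst + (v 0) • c00 p.snd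
/-- (see `A1`) -/
def A2 (p : Rho 𝔸) (v : P3) : 𝔸 :=
  (v 1 * v 2) • c11 p.fst + (v 0 * v 1) • c10 p.snd + (v 0 * v 2) • c01 p.snd
/-- (see `A1`) -/
def A3 (p : Rho 𝔸) (v : P3) : 𝔸 := (v 0 * v 1 * v 2) • c11 p.snd

/-- `ev p` restricted to a line `u ↦ u • v` is the cubic `c00 + u A1 + u² A2 + u³ A3`. -/
theorem ev_line (p : Rho 𝔸) (v : P3) (u : ℂ) :
    ev p (u • v) = c00 p.fst + u • A1 p v + (u * u) • A2 p v + (u * u * u) • A3 p v := by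
  simp only [ev, evT, A1, A2, A3, Pi.smul_apply, smul_eq_mul, smul_add, smul_smul]
  module

/-- Core of uniqueness: a flat polynomial germ is zero.  Orders `0,1,2` by limits along lines through `0`,
order `3` by the derivative along the four lines `(1,1,1)`, `(−1,1,1)`, `(1,−1,1)`, `(1,1,−1)`. -/
theorem eq_zero_of_ev_mem_flat (hp : ev p ∈ flat) : p = 0 := by
  obtain ⟨r₀, r₁, r₂, h₀, h₁, h₂, hx⟩ := mem_flat.1 hp
  -- order 0
  have hc00 : c00 p.fst = 0 := by simpa using hx.self_of_nhds
  -- the line remainder `R_v(u) = Σ vᵢ² • rᵢ(u v)`, its value and derivative at `0`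
  have hsm : ∀ v : P3, AnalyticAt ℂ (fun u : ℂ => u • v) 0 := fun v => by fun_prop
  have hRa : ∀ v : P3, AnalyticAt ℂ
      (fun u : ℂ => (v 0) ^ 2 • r₀ (u • v) + (v 1) ^ 2 • r₁ (u • v) + (v 2) ^ 2 • r₂ (u • v)) 0 := by
    intro v
    have g₀ : AnalyticAt ℂ (fun u : ℂ => r₀ (u • v)) 0 := h₀.fun_comp_of_eq (hsm v) (by simp)
    have g₁ : AnalyticAt ℂ (fun u : ℂ => r₁ (u • v)) 0 := h₁.fun_comp_of_eq (hsm v) (by simp)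
    have g₂ : AnalyticAt ℂ (fun u : ℂ => r₂ (u • v)) 0 := h₂.fun_comp_of_eq (hsm v) (by simp)
    exact (g₀.fun_const_smul.fun_add g₁.fun_const_smul).fun_add g₂.fun_const_smul
  have hRd : ∀ v : P3, deriv
      (fun u : ℂ => (v 0) ^ 2 • r₀ (u • v) + (v 1) ^ 2 • r₁ (u • v) + (v 2) ^ 2 • r₂ (u • v)) 0
      = (v 0) ^ 2 • (fderiv ℂ r₀ 0) v + (v 1) ^ 2 • (fderiv ℂ r₁ 0) v + (v 2) ^ 2 • (fderiv ℂ r₂ 0) v := by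
    intro v
    have hs : HasDerivAt (fun u : ℂ => u • v) v 0 := by
      simpa using (hasDerivAt_id (0 : ℂ)).smul_const v
    have d₀ : HasDerivAt (fun u : ℂ => r₀ (u • v)) ((fderiv ℂ r₀ 0) v) 0 :=
      h₀.differentiableAt.hasFDerivAt.comp_hasDerivAt_of_eq (0 : ℂ) hs (by simp)
    have d₁ : HasDerivAt (fun u : ℂ => r₁ (u • v)) ((fderiv ℂ r₁ 0) v) 0 :=
      h₁.differentiableAt.hasFDerivAt.comp_hasDerivAt_of_eq (0 : ℂ) hs (by simp)
    have d₂ : HasDerivAt (fun u : ℂ => r₂ (u • v)) ((fderiv ℂ r₂ 0) v) 0 :=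
      h₂.differentiableAt.hasFDerivAt.comp_hasDerivAt_of_eq (0 : ℂ) hs (by simp)
    exact (((d₀.fun_const_smul ((v 0) ^ 2)).fun_add (d₁.fun_const_smul ((v 1) ^ 2))).fun_add
      (d₂.fun_const_smul ((v 2) ^ 2))).deriv
  -- restriction of the flatness identity to lines, and the three coefficient identities
  have hco : ∀ v : P3, A1 p v = 0 ∧ A2 p v = (v 0) ^ 2 • r₀ 0 + (v 1) ^ 2 • r₁ 0 + (v 2) ^ 2 • r₂ 0 ∧
      A3 p v = (v 0) ^ 2 • (fderiv ℂ r₀ 0) v + (v 1) ^ 2 • (fderiv ℂ r₁ 0) v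
        + (v 2) ^ 2 • (fderiv ℂ r₂ 0) v := by
    intro v
    have ht : Tendsto (fun u : ℂ => u • v) (𝓝 0) (𝓝 0) := by
      simpa using (hsm v).continuousAt.tendsto
    have hl : ∀ᶠ u in 𝓝 (0 : ℂ), u • A1 p v + (u * u) • A2 p v + (u * u * u) • A3 p v
        = (u * u) • ((v 0) ^ 2 • r₀ (u • v) + (v 1) ^ 2 • r₁ (u • v) + (v 2) ^ 2 • r₂ (u • v)) := by
      filter_upwards [ht.eventually hx] with u hu
      have e := ev_line p v u
      rw [hc00, zero_add] at e
      rw [← e, hu]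
      simp only [Pi.smul_apply, smul_eq_mul]
      module
    obtain ⟨k1, k2, k3⟩ := line_coeffs (hRa v) hl
    refine ⟨k1, by simpa using k2, by rw [k3, hRd]⟩
  -- reading off: order 1
  have k1 : c00 p.snd = 0 := by simpa [A1] using (hco (Pi.single 0 1)).1
  have k2 : c10 p.fst = 0 := by simpa [A1] using (hco (Pi.single 1 1)).1
  have k3 : c01 p.fst = 0 := by simpa [A1] using (hco (Pi.single 2 1)).1
  -- order 2
  have z0 : r₀ 0 = 0 := by simpa [A2] using ((hco (Pi.single 0 1)).2.1).symm
  have z1 : r₁ 0 = 0 := by simpa [A2] using ((hco (Pi.single 1 1)).2.1).symm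
  have z2 : r₂ 0 = 0 := by simpa [A2] using ((hco (Pi.single 2 1)).2.1).symm
  have m12 : c11 p.fst = 0 := by
    simpa [A2, z1, z2] using (hco (fun i => if i = 0 then (0 : ℂ) else 1)).2.1
  have m01 : c10 p.snd = 0 := by
    simpa [A2, z0, z1] using (hco (fun i => if i = 2 then (0 : ℂ) else 1)).2.1
  have m02 : c01 p.snd = 0 := by
    simpa [A2, z0, z2] using (hco (fun i => if i = 1 then (0 : ℂ) else 1)).2.1
  -- order 3: the four sign patterns `(1,1,1)`, `(−1,1,1)`, `(1,−1,1)`, `(1,1,−1)`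
  set L₀ := fderiv ℂ r₀ 0; set L₁ := fderiv ℂ r₁ 0; set L₂ := fderiv ℂ r₂ 0
  have n0 : c11 p.snd = L₀ w3 + L₁ w3 + L₂ w3 := by simpa [A3] using (hco w3).2.2
  have f0 : -c11 p.snd = L₀ u0 + L₁ u0 + L₂ u0 := by simpa [A3] using (hco u0).2.2
  have f1 : -c11 p.snd = L₀ u1 + L₁ u1 + L₂ u1 := by simpa [A3] using (hco u1).2.2
  have f2 : -c11 p.snd = L₀ u2 + L₁ u2 + L₂ u2 := by simpa [A3] using (hco u2).2.2
  have key : ∀ L : P3 →L[ℂ] 𝔸, L w3 - L u0 - L u1 - L u2 = 0 := by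
    intro L; rw [← map_sub, ← map_sub, ← map_sub, w3_sub, map_zero]
  have h4 : (4 : ℂ) • c11 p.snd = 0 := by
    calc (4 : ℂ) • c11 p.snd = c11 p.snd - (-c11 p.snd) - (-c11 p.snd) - (-c11 p.snd) := by module
      _ = (L₀ w3 + L₁ w3 + L₂ w3) - (L₀ u0 + L₁ u0 + L₂ u0) - (L₀ u1 + L₁ u1 + L₂ u1)
          - (L₀ u2 + L₁ u2 + L₂ u2) := by rw [← n0, ← f0, ← f1, ← f2]
      _ = (L₀ w3 - L₀ u0 - L₀ u1 - L₀ u2) + (L₁ w3 - L₁ u0 - L₁ u1 - L₁ u2)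
          + (L₂ w3 - L₂ u0 - L₂ u1 - L₂ u2) := by abel
      _ = 0 := by rw [key, key, key, add_zero, add_zero]
  have hc11 : c11 p.snd = 0 := (smul_eq_zero.1 h4).resolve_left (by norm_num)
  -- assemble
  have hfst : p.fst = 0 :=
    ext4 (by simpa using hc00) (by simpa using k2) (by simpa using k3) (by simpa using m12)
  have hsnd : p.snd = 0 :=
    ext4 (by simpa using k1) (by simpa using m01) (by simpa using m02) (by simpa using hc11)
  exact TrivSqZeroExt.ext hfst hsnd

/-- [folklore] UNIQUENESS OF THE JET: an analytic germ has at most one multilinear 3-jet. -/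
theorem mem_jets_unique {f : P3 → 𝔸} {q q' : Rho 𝔸} (h : q ∈ jets f) (h' : q' ∈ jets f) : q = q' := by
  have hd : ev (q' - q) ∈ flat :=
    flat_congr (flat_sub (mem_jets.1 h) (mem_jets.1 h')) (Eventually.of_forall fun x => by simp only [ev_sub]; abel)
  exact (sub_eq_zero.1 (eq_zero_of_ev_mem_flat hd)).symm

/-- [folklore] (restated) `jets f` has at most one element. -/
theorem jets_subsingleton (f : P3 → 𝔸) : (jets f).Subsingleton := fun _ h _ h' => mem_jets_unique h h'

end Unique

end Summit.QuantumFields.BalabanUV.Beta.MultilinearJet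

end
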